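import Mathlib
import HarnessLib
import Summits.ValiantsHypothesis.ValiantsHypothesis.Theorems.LacunarySymmetroidMatrixDescartesOsculationLawRankTwoColumnDet
import Summits.ValiantsHypothesis.ValiantsHypothesis.Theorems.LacunarySymmetroidMatrixDescartesOsculationLawPeelRankTwoCurve

/-!
# ValiantsHypothesis / LacunarySymmetroid — crux `MatrixDescartes` (stmt-ValiantsHypothesis-18050, V1),
# line `Cruxes/MatrixDescartes/Lines/osculation_law.lean` («osculation-law»): `PeelInequality` AT RANK TWO

The line's theorem-shaped stub is `stub_peel : PeelInequality` — for every block splitting `r + s`, inserting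
the arc `b = c·t^N` into the spectral curve `Φ = det(Σ_l X₀^(d l) S_l + X₁·(I_r ⊕ 0))` costs at most
`2·#osc + 2r + 2·Z₊mult(blockDet) + 3·Z₊mult(lowerDet)` positive roots (osculation set finite and in general
position).  `OsculationPeel.peelInequality_rankOne` (this directory) is the `r = 1` instance; THIS FILE is the
**`r = 2` instance, stated token-for-token as `PeelInequality` with `r := 2` and every line definition unfolded**
(desk RULING #249 (a) [ii′]):

* `insertedDet_eq_two` — over `ℝ[X]` the inserted determinant is the quadratic
  `a·(cX^N)² + m·(cX^N) + δ` of `OsculationRankTwo.det_add_smul_blockProj_two` (a = det of the lower-block pencil,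
  m = the two diagonal cofactors, δ = det of the pencil);
* `peelInequality_rankTwo` — `OsculationRankTwo.insertionPoly_two` identifies `Φ` with the quadratic spectral
  curve `X₁X₁·ι a + X₁·ι m + ι δ`, `OsculationRankTwo.hdisc_two` (symmetric letters are real-rooted) supplies
  hyperbolicity `4aδ ≤ m²`, and `OsculationPeel.peel_curve_two` (the per-branch cut scheme: branch-arc engine,
  pigeonhole, no-fold events, branch regularity) gives the count.

Honest framing: this is the `r = 2` INSTANCE of an OPEN stub (`stub_peel` quantifies over all `r`); the LAW,
`MatrixDescartes`, Conjecture B and `VP ≠ VNP` are NOT proved.  No definitions, no named facts.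
-/

-- `Summit.ValiantsHypothesis.ValiantsHypothesis.…` is the tree's mandated single-conjunct layout (Sub = Summit).
set_option linter.dupNamespace false

noncomputable section

namespace Summit.ValiantsHypothesis.ValiantsHypothesis.Theorems.LacunarySymmetroidMatrixDescartes

open Polynomial Set
open scoped BigOperators

namespace OsculationPeel

/-- Over `ℝ[X]`, inserting `b = c·X^N` into the `(2, s)` block pencil gives the quadratic
`a·(cX^N)² + m·(cX^N) + δ` (`OsculationRankTwo.det_add_smul_blockProj_two`). [folklore] -/
theorem insertedDet_eq_two {s K : ℕ} (d : Fin K → ℕ) (S : Fin K → Matrix (Fin 2 ⊕ Fin s) (Fin 2 ⊕ Fin s) ℝ)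
    (c : ℝ) (N : ℕ) :
    (∑ l, (X : ℝ[X]) ^ d l • (S l).map Polynomial.C
        + (Polynomial.C c * (X : ℝ[X]) ^ N) •
          (Matrix.fromBlocks 1 0 0 0 : Matrix (Fin 2 ⊕ Fin s) (Fin 2 ⊕ Fin s) ℝ).map Polynomial.C).det =
      (∑ l, (X : ℝ[X]) ^ d l • ((S l).toBlocks₂₂).map Polynomial.C).det * (Polynomial.C c * X ^ N) ^ 2
        + (((∑ l, (X : ℝ[X]) ^ d l • (S l).map Polynomial.C).updateRow (Sum.inl 0)
              (Pi.single (Sum.inl 0) 1 : Fin 2 ⊕ Fin s → ℝ[X])).det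
            + ((∑ l, (X : ℝ[X]) ^ d l • (S l).map Polynomial.C).updateRow (Sum.inl 1)
              (Pi.single (Sum.inl 1) 1 : Fin 2 ⊕ Fin s → ℝ[X])).det) * (Polynomial.C c * X ^ N)
        + (∑ l, (X : ℝ[X]) ^ d l • (S l).map Polynomial.C).det := by
  rw [OsculationRankTwo.blockProj_map (map_zero _) (map_one _), OsculationRankTwo.det_add_smul_blockProj_two,
    OsculationRankTwo.toBlocks₂₂_pencil]
  ring

/-- **`PeelInequality` at rank two** — the statement of `Cruxes/…/Lines/osculation_law.lean :: PeelInequality`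
with `r := 2`, every line definition unfolded. [folklore] -/
theorem peelInequality_rankTwo :
    ∀ (s K : ℕ) (d : Fin K → ℕ) (S : Fin K → Matrix (Fin 2 ⊕ Fin s) (Fin 2 ⊕ Fin s) ℝ) (c : ℝ) (N : ℕ),
      (∀ l, (S l).IsSymm) → 0 < c → (∑ l, (X : ℝ[X]) ^ d l • (S l).map Polynomial.C).det ≠ 0 → (∑ l, (X : ℝ[X]) ^ d l • ((S l).toBlocks₂₂).map Polynomial.C).det ≠ 0 →
      {p : Fin 2 → ℝ | 0 < p 0 ∧ 0 < p 1 ∧ MvPolynomial.eval p (∑ l, (MvPolynomial.X (0 : Fin 2) : MvPolynomial (Fin 2) ℝ) ^ d l •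
              (S l).map (MvPolynomial.C : ℝ →+* MvPolynomial (Fin 2) ℝ)
            + (MvPolynomial.X (1 : Fin 2) : MvPolynomial (Fin 2) ℝ) •
              (Matrix.fromBlocks 1 0 0 0 : Matrix (Fin 2 ⊕ Fin s) (Fin 2 ⊕ Fin s) ℝ).map
                (MvPolynomial.C : ℝ →+* MvPolynomial (Fin 2) ℝ)).det = 0 ∧
      MvPolynomial.eval p
        (MvPolynomial.X 0 * MvPolynomial.pderiv 0 (MvPolynomial.X 0 * MvPolynomial.pderiv 0 (∑ l, (MvPolynomial.X (0 : Fin 2) : MvPolynomial (Fin 2) ℝ) ^ d l •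
              (S l).map (MvPolynomial.C : ℝ →+* MvPolynomial (Fin 2) ℝ)
            + (MvPolynomial.X (1 : Fin 2) : MvPolynomial (Fin 2) ℝ) •
              (Matrix.fromBlocks 1 0 0 0 : Matrix (Fin 2 ⊕ Fin s) (Fin 2 ⊕ Fin s) ℝ).map
                (MvPolynomial.C : ℝ →+* MvPolynomial (Fin 2) ℝ)).det)
            * (MvPolynomial.X 1 * MvPolynomial.pderiv 1 (∑ l, (MvPolynomial.X (0 : Fin 2) : MvPolynomial (Fin 2) ℝ) ^ d l •
              (S l).map (MvPolynomial.C : ℝ →+* MvPolynomial (Fin 2) ℝ)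
            + (MvPolynomial.X (1 : Fin 2) : MvPolynomial (Fin 2) ℝ) •
              (Matrix.fromBlocks 1 0 0 0 : Matrix (Fin 2 ⊕ Fin s) (Fin 2 ⊕ Fin s) ℝ).map
                (MvPolynomial.C : ℝ →+* MvPolynomial (Fin 2) ℝ)).det) ^ 2
          - 2 * (MvPolynomial.X 0 * MvPolynomial.pderiv 0 (MvPolynomial.X 1 * MvPolynomial.pderiv 1 (∑ l, (MvPolynomial.X (0 : Fin 2) : MvPolynomial (Fin 2) ℝ) ^ d l •
              (S l).map (MvPolynomial.C : ℝ →+* MvPolynomial (Fin 2) ℝ)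
            + (MvPolynomial.X (1 : Fin 2) : MvPolynomial (Fin 2) ℝ) •
              (Matrix.fromBlocks 1 0 0 0 : Matrix (Fin 2 ⊕ Fin s) (Fin 2 ⊕ Fin s) ℝ).map
                (MvPolynomial.C : ℝ →+* MvPolynomial (Fin 2) ℝ)).det))
            * (MvPolynomial.X 0 * MvPolynomial.pderiv 0 (∑ l, (MvPolynomial.X (0 : Fin 2) : MvPolynomial (Fin 2) ℝ) ^ d l •
              (S l).map (MvPolynomial.C : ℝ →+* MvPolynomial (Fin 2) ℝ)
            + (MvPolynomial.X (1 : Fin 2) : MvPolynomial (Fin 2) ℝ) •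
              (Matrix.fromBlocks 1 0 0 0 : Matrix (Fin 2 ⊕ Fin s) (Fin 2 ⊕ Fin s) ℝ).map
                (MvPolynomial.C : ℝ →+* MvPolynomial (Fin 2) ℝ)).det) * (MvPolynomial.X 1 * MvPolynomial.pderiv 1 (∑ l, (MvPolynomial.X (0 : Fin 2) : MvPolynomial (Fin 2) ℝ) ^ d l •
              (S l).map (MvPolynomial.C : ℝ →+* MvPolynomial (Fin 2) ℝ)
            + (MvPolynomial.X (1 : Fin 2) : MvPolynomial (Fin 2) ℝ) •
              (Matrix.fromBlocks 1 0 0 0 : Matrix (Fin 2 ⊕ Fin s) (Fin 2 ⊕ Fin s) ℝ).map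
                (MvPolynomial.C : ℝ →+* MvPolynomial (Fin 2) ℝ)).det)
          + MvPolynomial.X 1 * MvPolynomial.pderiv 1 (MvPolynomial.X 1 * MvPolynomial.pderiv 1 (∑ l, (MvPolynomial.X (0 : Fin 2) : MvPolynomial (Fin 2) ℝ) ^ d l •
              (S l).map (MvPolynomial.C : ℝ →+* MvPolynomial (Fin 2) ℝ)
            + (MvPolynomial.X (1 : Fin 2) : MvPolynomial (Fin 2) ℝ) •
              (Matrix.fromBlocks 1 0 0 0 : Matrix (Fin 2 ⊕ Fin s) (Fin 2 ⊕ Fin s) ℝ).map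
                (MvPolynomial.C : ℝ →+* MvPolynomial (Fin 2) ℝ)).det)
            * (MvPolynomial.X 0 * MvPolynomial.pderiv 0 (∑ l, (MvPolynomial.X (0 : Fin 2) : MvPolynomial (Fin 2) ℝ) ^ d l •
              (S l).map (MvPolynomial.C : ℝ →+* MvPolynomial (Fin 2) ℝ)
            + (MvPolynomial.X (1 : Fin 2) : MvPolynomial (Fin 2) ℝ) •
              (Matrix.fromBlocks 1 0 0 0 : Matrix (Fin 2 ⊕ Fin s) (Fin 2 ⊕ Fin s) ℝ).map
                (MvPolynomial.C : ℝ →+* MvPolynomial (Fin 2) ℝ)).det) ^ 2) = 0}.Finite →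
      (∀ p ∈ {p : Fin 2 → ℝ | 0 < p 0 ∧ 0 < p 1 ∧ MvPolynomial.eval p (∑ l, (MvPolynomial.X (0 : Fin 2) : MvPolynomial (Fin 2) ℝ) ^ d l •
              (S l).map (MvPolynomial.C : ℝ →+* MvPolynomial (Fin 2) ℝ)
            + (MvPolynomial.X (1 : Fin 2) : MvPolynomial (Fin 2) ℝ) •
              (Matrix.fromBlocks 1 0 0 0 : Matrix (Fin 2 ⊕ Fin s) (Fin 2 ⊕ Fin s) ℝ).map
                (MvPolynomial.C : ℝ →+* MvPolynomial (Fin 2) ℝ)).det = 0 ∧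
      MvPolynomial.eval p
        (MvPolynomial.X 0 * MvPolynomial.pderiv 0 (MvPolynomial.X 0 * MvPolynomial.pderiv 0 (∑ l, (MvPolynomial.X (0 : Fin 2) : MvPolynomial (Fin 2) ℝ) ^ d l •
              (S l).map (MvPolynomial.C : ℝ →+* MvPolynomial (Fin 2) ℝ)
            + (MvPolynomial.X (1 : Fin 2) : MvPolynomial (Fin 2) ℝ) •
              (Matrix.fromBlocks 1 0 0 0 : Matrix (Fin 2 ⊕ Fin s) (Fin 2 ⊕ Fin s) ℝ).map
                (MvPolynomial.C : ℝ →+* MvPolynomial (Fin 2) ℝ)).det)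
            * (MvPolynomial.X 1 * MvPolynomial.pderiv 1 (∑ l, (MvPolynomial.X (0 : Fin 2) : MvPolynomial (Fin 2) ℝ) ^ d l •
              (S l).map (MvPolynomial.C : ℝ →+* MvPolynomial (Fin 2) ℝ)
            + (MvPolynomial.X (1 : Fin 2) : MvPolynomial (Fin 2) ℝ) •
              (Matrix.fromBlocks 1 0 0 0 : Matrix (Fin 2 ⊕ Fin s) (Fin 2 ⊕ Fin s) ℝ).map
                (MvPolynomial.C : ℝ →+* MvPolynomial (Fin 2) ℝ)).det) ^ 2
          - 2 * (MvPolynomial.X 0 * MvPolynomial.pderiv 0 (MvPolynomial.X 1 * MvPolynomial.pderiv 1 (∑ l, (MvPolynomial.X (0 : Fin 2) : MvPolynomial (Fin 2) ℝ) ^ d l •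
              (S l).map (MvPolynomial.C : ℝ →+* MvPolynomial (Fin 2) ℝ)
            + (MvPolynomial.X (1 : Fin 2) : MvPolynomial (Fin 2) ℝ) •
              (Matrix.fromBlocks 1 0 0 0 : Matrix (Fin 2 ⊕ Fin s) (Fin 2 ⊕ Fin s) ℝ).map
                (MvPolynomial.C : ℝ →+* MvPolynomial (Fin 2) ℝ)).det))
            * (MvPolynomial.X 0 * MvPolynomial.pderiv 0 (∑ l, (MvPolynomial.X (0 : Fin 2) : MvPolynomial (Fin 2) ℝ) ^ d l •
              (S l).map (MvPolynomial.C : ℝ →+* MvPolynomial (Fin 2) ℝ)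
            + (MvPolynomial.X (1 : Fin 2) : MvPolynomial (Fin 2) ℝ) •
              (Matrix.fromBlocks 1 0 0 0 : Matrix (Fin 2 ⊕ Fin s) (Fin 2 ⊕ Fin s) ℝ).map
                (MvPolynomial.C : ℝ →+* MvPolynomial (Fin 2) ℝ)).det) * (MvPolynomial.X 1 * MvPolynomial.pderiv 1 (∑ l, (MvPolynomial.X (0 : Fin 2) : MvPolynomial (Fin 2) ℝ) ^ d l •
              (S l).map (MvPolynomial.C : ℝ →+* MvPolynomial (Fin 2) ℝ)
            + (MvPolynomial.X (1 : Fin 2) : MvPolynomial (Fin 2) ℝ) •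
              (Matrix.fromBlocks 1 0 0 0 : Matrix (Fin 2 ⊕ Fin s) (Fin 2 ⊕ Fin s) ℝ).map
                (MvPolynomial.C : ℝ →+* MvPolynomial (Fin 2) ℝ)).det)
          + MvPolynomial.X 1 * MvPolynomial.pderiv 1 (MvPolynomial.X 1 * MvPolynomial.pderiv 1 (∑ l, (MvPolynomial.X (0 : Fin 2) : MvPolynomial (Fin 2) ℝ) ^ d l •
              (S l).map (MvPolynomial.C : ℝ →+* MvPolynomial (Fin 2) ℝ)
            + (MvPolynomial.X (1 : Fin 2) : MvPolynomial (Fin 2) ℝ) •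
              (Matrix.fromBlocks 1 0 0 0 : Matrix (Fin 2 ⊕ Fin s) (Fin 2 ⊕ Fin s) ℝ).map
                (MvPolynomial.C : ℝ →+* MvPolynomial (Fin 2) ℝ)).det)
            * (MvPolynomial.X 0 * MvPolynomial.pderiv 0 (∑ l, (MvPolynomial.X (0 : Fin 2) : MvPolynomial (Fin 2) ℝ) ^ d l •
              (S l).map (MvPolynomial.C : ℝ →+* MvPolynomial (Fin 2) ℝ)
            + (MvPolynomial.X (1 : Fin 2) : MvPolynomial (Fin 2) ℝ) •
              (Matrix.fromBlocks 1 0 0 0 : Matrix (Fin 2 ⊕ Fin s) (Fin 2 ⊕ Fin s) ℝ).map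
                (MvPolynomial.C : ℝ →+* MvPolynomial (Fin 2) ℝ)).det) ^ 2) = 0},
          MvPolynomial.eval p (MvPolynomial.pderiv 1 (∑ l, (MvPolynomial.X (0 : Fin 2) : MvPolynomial (Fin 2) ℝ) ^ d l •
              (S l).map (MvPolynomial.C : ℝ →+* MvPolynomial (Fin 2) ℝ)
            + (MvPolynomial.X (1 : Fin 2) : MvPolynomial (Fin 2) ℝ) •
              (Matrix.fromBlocks 1 0 0 0 : Matrix (Fin 2 ⊕ Fin s) (Fin 2 ⊕ Fin s) ℝ).map
                (MvPolynomial.C : ℝ →+* MvPolynomial (Fin 2) ℝ)).det) ≠ 0 ∧ p 1 ≠ c * p 0 ^ N) →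
        Multiset.card ((∑ l, (X : ℝ[X]) ^ d l • (S l).map Polynomial.C
            + (Polynomial.C c * (X : ℝ[X]) ^ N) •
              (Matrix.fromBlocks 1 0 0 0 : Matrix (Fin 2 ⊕ Fin s) (Fin 2 ⊕ Fin s) ℝ).map Polynomial.C).det.roots.filter (fun t => 0 < t)) ≤
          2 * {p : Fin 2 → ℝ | 0 < p 0 ∧ 0 < p 1 ∧ MvPolynomial.eval p (∑ l, (MvPolynomial.X (0 : Fin 2) : MvPolynomial (Fin 2) ℝ) ^ d l •
              (S l).map (MvPolynomial.C : ℝ →+* MvPolynomial (Fin 2) ℝ)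
            + (MvPolynomial.X (1 : Fin 2) : MvPolynomial (Fin 2) ℝ) •
              (Matrix.fromBlocks 1 0 0 0 : Matrix (Fin 2 ⊕ Fin s) (Fin 2 ⊕ Fin s) ℝ).map
                (MvPolynomial.C : ℝ →+* MvPolynomial (Fin 2) ℝ)).det = 0 ∧
      MvPolynomial.eval p
        (MvPolynomial.X 0 * MvPolynomial.pderiv 0 (MvPolynomial.X 0 * MvPolynomial.pderiv 0 (∑ l, (MvPolynomial.X (0 : Fin 2) : MvPolynomial (Fin 2) ℝ) ^ d l •
              (S l).map (MvPolynomial.C : ℝ →+* MvPolynomial (Fin 2) ℝ)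
            + (MvPolynomial.X (1 : Fin 2) : MvPolynomial (Fin 2) ℝ) •
              (Matrix.fromBlocks 1 0 0 0 : Matrix (Fin 2 ⊕ Fin s) (Fin 2 ⊕ Fin s) ℝ).map
                (MvPolynomial.C : ℝ →+* MvPolynomial (Fin 2) ℝ)).det)
            * (MvPolynomial.X 1 * MvPolynomial.pderiv 1 (∑ l, (MvPolynomial.X (0 : Fin 2) : MvPolynomial (Fin 2) ℝ) ^ d l •
              (S l).map (MvPolynomial.C : ℝ →+* MvPolynomial (Fin 2) ℝ)
            + (MvPolynomial.X (1 : Fin 2) : MvPolynomial (Fin 2) ℝ) •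
              (Matrix.fromBlocks 1 0 0 0 : Matrix (Fin 2 ⊕ Fin s) (Fin 2 ⊕ Fin s) ℝ).map
                (MvPolynomial.C : ℝ →+* MvPolynomial (Fin 2) ℝ)).det) ^ 2
          - 2 * (MvPolynomial.X 0 * MvPolynomial.pderiv 0 (MvPolynomial.X 1 * MvPolynomial.pderiv 1 (∑ l, (MvPolynomial.X (0 : Fin 2) : MvPolynomial (Fin 2) ℝ) ^ d l •
              (S l).map (MvPolynomial.C : ℝ →+* MvPolynomial (Fin 2) ℝ)
            + (MvPolynomial.X (1 : Fin 2) : MvPolynomial (Fin 2) ℝ) •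
              (Matrix.fromBlocks 1 0 0 0 : Matrix (Fin 2 ⊕ Fin s) (Fin 2 ⊕ Fin s) ℝ).map
                (MvPolynomial.C : ℝ →+* MvPolynomial (Fin 2) ℝ)).det))
            * (MvPolynomial.X 0 * MvPolynomial.pderiv 0 (∑ l, (MvPolynomial.X (0 : Fin 2) : MvPolynomial (Fin 2) ℝ) ^ d l •
              (S l).map (MvPolynomial.C : ℝ →+* MvPolynomial (Fin 2) ℝ)
            + (MvPolynomial.X (1 : Fin 2) : MvPolynomial (Fin 2) ℝ) •
              (Matrix.fromBlocks 1 0 0 0 : Matrix (Fin 2 ⊕ Fin s) (Fin 2 ⊕ Fin s) ℝ).map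
                (MvPolynomial.C : ℝ →+* MvPolynomial (Fin 2) ℝ)).det) * (MvPolynomial.X 1 * MvPolynomial.pderiv 1 (∑ l, (MvPolynomial.X (0 : Fin 2) : MvPolynomial (Fin 2) ℝ) ^ d l •
              (S l).map (MvPolynomial.C : ℝ →+* MvPolynomial (Fin 2) ℝ)
            + (MvPolynomial.X (1 : Fin 2) : MvPolynomial (Fin 2) ℝ) •
              (Matrix.fromBlocks 1 0 0 0 : Matrix (Fin 2 ⊕ Fin s) (Fin 2 ⊕ Fin s) ℝ).map
                (MvPolynomial.C : ℝ →+* MvPolynomial (Fin 2) ℝ)).det)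
          + MvPolynomial.X 1 * MvPolynomial.pderiv 1 (MvPolynomial.X 1 * MvPolynomial.pderiv 1 (∑ l, (MvPolynomial.X (0 : Fin 2) : MvPolynomial (Fin 2) ℝ) ^ d l •
              (S l).map (MvPolynomial.C : ℝ →+* MvPolynomial (Fin 2) ℝ)
            + (MvPolynomial.X (1 : Fin 2) : MvPolynomial (Fin 2) ℝ) •
              (Matrix.fromBlocks 1 0 0 0 : Matrix (Fin 2 ⊕ Fin s) (Fin 2 ⊕ Fin s) ℝ).map
                (MvPolynomial.C : ℝ →+* MvPolynomial (Fin 2) ℝ)).det)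
            * (MvPolynomial.X 0 * MvPolynomial.pderiv 0 (∑ l, (MvPolynomial.X (0 : Fin 2) : MvPolynomial (Fin 2) ℝ) ^ d l •
              (S l).map (MvPolynomial.C : ℝ →+* MvPolynomial (Fin 2) ℝ)
            + (MvPolynomial.X (1 : Fin 2) : MvPolynomial (Fin 2) ℝ) •
              (Matrix.fromBlocks 1 0 0 0 : Matrix (Fin 2 ⊕ Fin s) (Fin 2 ⊕ Fin s) ℝ).map
                (MvPolynomial.C : ℝ →+* MvPolynomial (Fin 2) ℝ)).det) ^ 2) = 0}.ncard + 2 * 2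
            + 2 * Multiset.card ((∑ l, (X : ℝ[X]) ^ d l • (S l).map Polynomial.C).det.roots.filter (fun t => 0 < t))
            + 3 * Multiset.card ((∑ l, (X : ℝ[X]) ^ d l • ((S l).toBlocks₂₂).map Polynomial.C).det.roots.filter (fun t => 0 < t)) := by
  intro s K d S c N hS hc hf ha hfin hgp
  rw [insertedDet_eq_two d S c N]
  exact peel_curve_two _ _ _ c N hc ha hf (fun t => by have := OsculationRankTwo.hdisc_two d S hS t; linarith)
    _ (OsculationRankTwo.insertionPoly_two d S) hfin hgp

end OsculationPeel

end Summit.ValiantsHypothesis.ValiantsHypothesis.Theorems.LacunarySymmetroidMatrixDescartes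

end
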